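import Literature.Barriers.CriticalPhenomena.SubexponentialGrowthZdProofs
import Mathlib.Data.Finset.Card
import HarnessLib

/-!
# Greedy extraction of separated points, generic (for Step III of the levels / skeleton re-typing of Kozma–Nitzan's Lemma 10)

builds on p205010 (kernel theorem, internal audit signed; external expert review pending) — nothing in this file uses p205010.
Lane `prim-bschramm`, seat `prim-bschramm-stmt` (support for p3-g2's F6: "a generic greedy packing lemma replacing `exists_subset_card_eq_separated`",
which is stated on `ℤ^d` with sup-distance boxes, `L/UniformPercolation.lean:76`).

* `exists_subset_card_eq_separated_of_near` — for ANY reflexive symmetric "nearness" relation whose neighbourhoods meet every finite set in at most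
  `N ≥ 1` points, a finite set of at least `K · N` points contains `K` pairwise non-near points (greedy: remove a point together with its
  near-neighbourhood, recurse);
* `exists_subset_card_eq_ballSeparated` — the graph-metric instance: nearness = "within graph distance `r`" (the tree's `graphBall`), `N ≥ 1` a uniform
  bound on the ball volumes `|B(x, r)|` (available on every quasi-transitive locally finite graph, and on the lane's lattices by their cubic growth;
  `N ≥ 1` is automatic on a non-empty graph by the tree's `one_le_ballVolume`).
[cite: KozmaNitzan2024, §4 Lemma 10 Step III (p. 19: far-apart contact vertices)] [cite: GrimmettPercolation1999, §2.6]
-/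

namespace Summit.CriticalPhenomena.PercolationContinuityZ3.Theorems.Transplant

open Literature.Barriers.CriticalPhenomena (graphBall ballVolume graphBall_finite mem_graphBall_self)

/-- **Greedy extraction of pairwise non-near points**: if `near` is reflexive and symmetric and every near-neighbourhood meets every finite set in at
most `N ≥ 1` points, then a finite set with at least `K · N` elements contains `K` pairwise non-near elements. [folklore] -/
theorem exists_subset_card_eq_separated_of_near {α : Type*} [DecidableEq α] (near : α → α → Prop) [DecidableRel near]
    (hrefl : ∀ x, near x x) (hsymm : ∀ x y, near x y → near y x) {N : ℕ} (hN0 : 0 < N)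
    (hN : ∀ (x : α) (S : Finset α), (S.filter (near x)).card ≤ N) :
    ∀ (K : ℕ) (S : Finset α), K * N ≤ S.card → ∃ T ⊆ S, T.card = K ∧ ∀ x ∈ T, ∀ y ∈ T, x ≠ y → ¬ near x y := by
  intro K
  induction K with
  | zero => intro S _; exact ⟨∅, Finset.empty_subset _, rfl, by simp⟩
  | succ K ih =>
    intro S hS
    have hSne : S.Nonempty := by
      rw [← Finset.card_pos]
      have : N ≤ (K + 1) * N := Nat.le_mul_of_pos_left _ (Nat.succ_pos K)
      omega
    obtain ⟨x, hx⟩ := hSne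
    -- the far part of `S`
    set S' := S.filter fun y => ¬ near x y with hS'
    have hnear : (S.filter fun y => near x y).card ≤ N := hN x S
    have hsplit : (S.filter fun y => near x y).card + S'.card = S.card := by
      rw [hS']; exact Finset.card_filter_add_card_filter_not _
    have hS'card : K * N ≤ S'.card := by
      have : (K + 1) * N = K * N + N := by ring
      omega
    obtain ⟨T', hT'S', hT'card, hT'sep⟩ := ih S' hS'card
    have hxT' : x ∉ T' := fun hxT => (Finset.mem_filter.1 (hT'S' hxT)).2 (hrefl x)
    refine ⟨insert x T', ?_, ?_, ?_⟩
    · intro y hy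
      rcases Finset.mem_insert.1 hy with rfl | hy
      · exact hx
      · exact (Finset.mem_filter.1 (hT'S' hy)).1
    · rw [Finset.card_insert_of_notMem hxT', hT'card]
    · intro a ha b hb hab
      rcases Finset.mem_insert.1 ha with hax | haT
      · rcases Finset.mem_insert.1 hb with hbx | hbT
        · exact absurd (hax.trans hbx.symm) hab
        · rw [hax]; exact (Finset.mem_filter.1 (hT'S' hbT)).2
      · rcases Finset.mem_insert.1 hb with hbx | hbT
        · rw [hbx]; exact fun h => (Finset.mem_filter.1 (hT'S' haT)).2 (hsymm _ _ h)
        · exact hT'sep a haT b hbT hab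

/-- **Ball-separated points in a graph**: if every ball of radius `r` of `G` has at most `N` vertices (`N ≥ 1`), a finite set of at least `K · N`
vertices contains `K` vertices pairwise at graph distance `> r` (no one in the `r`-ball of another). [cite: KozmaNitzan2024, §4 Lemma 10 Step III (p. 19)] -/
theorem exists_subset_card_eq_ballSeparated {V : Type*} [DecidableEq V] (G : SimpleGraph V) [G.LocallyFinite] (r : ℕ) {N : ℕ} (hN0 : 0 < N)
    (hN : ∀ x : V, ballVolume G x r ≤ N) (K : ℕ) (S : Finset V) (hS : K * N ≤ S.card) :
    ∃ T ⊆ S, T.card = K ∧ ∀ x ∈ T, ∀ y ∈ T, x ≠ y → y ∉ graphBall G x r := by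
  classical
  have hrefl : ∀ x : V, x ∈ graphBall G x r := fun x => mem_graphBall_self G x r
  have hsymm : ∀ x y : V, y ∈ graphBall G x r → x ∈ graphBall G y r := by
    rintro x y ⟨w, hw⟩
    exact ⟨w.reverse, by rw [SimpleGraph.Walk.length_reverse]; exact hw⟩
  refine exists_subset_card_eq_separated_of_near (fun x y => y ∈ graphBall G x r) hrefl hsymm hN0 (fun x S' => ?_) K S hS
  calc (S'.filter fun y => y ∈ graphBall G x r).card
      = (↑(S'.filter fun y => y ∈ graphBall G x r) : Set V).ncard := (Set.ncard_coe_finset _).symm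
    _ ≤ (graphBall G x r).ncard := Set.ncard_le_ncard (fun y hy => (Finset.mem_filter.1 (Finset.mem_coe.1 hy)).2) (graphBall_finite G x r)
    _ ≤ N := hN x

end Summit.CriticalPhenomena.PercolationContinuityZ3.Theorems.Transplant
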